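import Mathlib.Analysis.SpecialFunctions.SmoothTransition
import Mathlib.Analysis.Calculus.LocalExtr.Basic
import Mathlib.Analysis.Calculus.Deriv.Pow
import Mathlib.Analysis.Calculus.Deriv.Comp
import Mathlib.Analysis.Calculus.Deriv.Mul
import Mathlib.MeasureTheory.Integral.IntervalIntegral.FundThmCalculus
import Mathlib.Topology.Algebra.Support
import HarnessLib

/-!
# Smooth profile transitions and their kernels (radial test weights for Lelong numbers)

Elementary real-variable input for the Monge–Ampère computation of Lelong numbers of analytic
sets ([Chirka1989, §15.1], [Demailly, *Complex analytic and differential geometry*, Ch. III §5–7]):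
the radial weights used there are `u(z) = g(log ‖z‖)` with `g` convex, non-decreasing, constant far
to the left and equal to the identity (up to an additive constant) far to the right — i.e. `g' = h`
is a **profile transition**:

* `IsProfileTransition h s ε` — `h : ℝ → ℝ` is smooth, monotone, `= 0` on `(-∞, s - ε]` and `= 1`
  on `[s + ε, ∞)`; such `h` exist for every `s` and every `ε > 0`
  (`exists_isProfileTransition`, from `Real.smoothTransition`), take values in `[0, 1]`, have a
  continuous, bounded, non-negative derivative supported in `[s - ε, s + ε]`, and translate
  (`IsProfileTransition.comp_sub`);
* `profileKernel h p = ½ h^{p-1} h'` (`p ≥ 1`) — the kernel appearing in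
  `(dd^c g(log‖z‖))^p` along a complex `p`-plane; it is non-negative, vanishes off
  `[s - ε, s + ε]`, and `∫_a^b ½ h^{p-1} h' = (h(b)^p - h(a)^p)/(2p)`
  (`integral_profileKernel`), in particular its total mass is `1/(2p)`.

Everything is a definition with a body or a proved theorem (Mathlib only).

## References

* E. M. Chirka, *Complex Analytic Sets*, Kluwer 1989, §15.1 [Chirka1989].
* J.-P. Demailly, *Complex analytic and differential geometry*, Ch. III §5 (generalised Lelong
  numbers with respect to a weight).
-/

noncomputable section

open Set Filter MeasureTheory intervalIntegral
open scoped Topology ContDiff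

namespace Literature.Geometry.GeometricMeasureTheory

/-- A **profile transition** at scale `ε` around `s`: a smooth monotone `h : ℝ → ℝ` with `h = 0` on
`(-∞, s - ε]` and `h = 1` on `[s + ε, ∞)` (the derivative `g'` of a convex non-decreasing profile
`g` which is constant far left and a translate of the identity far right). [folklore] -/
structure IsProfileTransition (h : ℝ → ℝ) (s ε : ℝ) : Prop where
  contDiff : ContDiff ℝ ∞ h
  monotone : Monotone h
  eq_zero_of_le : ∀ x, x ≤ s - ε → h x = 0
  eq_one_of_le : ∀ x, s + ε ≤ x → h x = 1

/-- **Profile transitions exist** at every location and every positive scale: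
`h(x) = smoothTransition ((x - s + ε)/(2ε))`. [folklore] -/
theorem exists_isProfileTransition (s : ℝ) {ε : ℝ} (hε : 0 < ε) :
    ∃ h, IsProfileTransition h s ε := by
  refine ⟨fun x => Real.smoothTransition ((x - s + ε) / (2 * ε)), ?_, ?_, ?_, ?_⟩
  · exact Real.smoothTransition.contDiff.comp ((contDiff_id.sub contDiff_const).add contDiff_const
      |>.div_const _)
  · intro x y hxy
    apply Real.smoothTransition.monotone
    gcongr
  · intro x hx
    apply Real.smoothTransition.zero_of_nonpos
    apply div_nonpos_of_nonpos_of_nonneg <;> linarith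
  · intro x hx
    apply Real.smoothTransition.one_of_one_le
    rw [le_div_iff₀ (by linarith)]
    linarith

namespace IsProfileTransition

variable {h : ℝ → ℝ} {s ε : ℝ}

/-- A profile transition is non-negative. [folklore] -/
theorem nonneg (hh : IsProfileTransition h s ε) (x : ℝ) : 0 ≤ h x := by
  rcases le_total x (s - ε) with hx | hx
  · rw [hh.eq_zero_of_le x hx]
  · rw [← hh.eq_zero_of_le (s - ε) le_rfl]
    exact hh.monotone hx

/-- A profile transition is at most `1`. [folklore] -/
theorem le_one (hh : IsProfileTransition h s ε) (x : ℝ) : h x ≤ 1 := by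
  rcases le_total x (s + ε) with hx | hx
  · rw [← hh.eq_one_of_le (s + ε) le_rfl]
    exact hh.monotone hx
  · rw [hh.eq_one_of_le x hx]

/-- A profile transition is differentiable. [folklore] -/
theorem differentiable (hh : IsProfileTransition h s ε) : Differentiable ℝ h :=
  hh.contDiff.differentiable (by simp)

/-- A profile transition has derivative `deriv h`. [folklore] -/
theorem hasDerivAt (hh : IsProfileTransition h s ε) (x : ℝ) : HasDerivAt h (deriv h x) x :=
  (hh.differentiable x).hasDerivAt

/-- The derivative of a profile transition is smooth. [folklore] -/
theorem contDiff_deriv (hh : IsProfileTransition h s ε) : ContDiff ℝ ∞ (deriv h) := by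
  have := hh.contDiff
  rw [show (∞ : WithTop ℕ∞) = ∞ + 1 from rfl] at this
  exact (contDiff_succ_iff_deriv.1 this).2.2

/-- The derivative of a profile transition is continuous. [folklore] -/
theorem continuous_deriv (hh : IsProfileTransition h s ε) : Continuous (deriv h) :=
  hh.contDiff_deriv.continuous

/-- The derivative of a profile transition is non-negative (monotonicity). [folklore] -/
theorem deriv_nonneg (hh : IsProfileTransition h s ε) (x : ℝ) : 0 ≤ deriv h x :=
  (hh.hasDerivAt x).nonneg_of_monotone hh.monotone

/-- Left of `s - ε` the derivative vanishes (every such point is a local minimum, `h ≥ 0 = h x`).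
[folklore] -/
theorem deriv_eq_zero_of_le (hh : IsProfileTransition h s ε) {x : ℝ} (hx : x ≤ s - ε) :
    deriv h x = 0 := by
  apply IsLocalMin.deriv_eq_zero
  filter_upwards with y
  rw [hh.eq_zero_of_le x hx]
  exact hh.nonneg y

/-- Right of `s + ε` the derivative vanishes (every such point is a local maximum, `h ≤ 1 = h x`).
[folklore] -/
theorem deriv_eq_zero_of_ge (hh : IsProfileTransition h s ε) {x : ℝ} (hx : s + ε ≤ x) :
    deriv h x = 0 := by
  apply IsLocalMax.deriv_eq_zero
  filter_upwards with y
  rw [hh.eq_one_of_le x hx]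
  exact hh.le_one y

/-- The derivative of a profile transition vanishes off the open band `|x - s| < ε`. [folklore] -/
theorem deriv_eq_zero_of_lt_abs (hh : IsProfileTransition h s ε) {x : ℝ} (hx : ε ≤ |x - s|) :
    deriv h x = 0 := by
  rcases le_abs'.1 hx with h1 | h1
  · exact hh.deriv_eq_zero_of_le (by linarith)
  · exact hh.deriv_eq_zero_of_ge (by linarith)

/-- The derivative of a profile transition is supported in `[s - ε, s + ε]`. [folklore] -/
theorem tsupport_deriv_subset (hh : IsProfileTransition h s ε) :
    tsupport (deriv h) ⊆ Icc (s - ε) (s + ε) := by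
  apply closure_minimal _ isClosed_Icc
  intro x hx
  rw [Function.mem_support] at hx
  by_contra hx'
  simp only [mem_Icc, not_and_or, not_le] at hx'
  rcases hx' with h1 | h1
  · exact hx (hh.deriv_eq_zero_of_le h1.le)
  · exact hx (hh.deriv_eq_zero_of_ge h1.le)

/-- The derivative of a profile transition has compact support. [folklore] -/
theorem hasCompactSupport_deriv (hh : IsProfileTransition h s ε) : HasCompactSupport (deriv h) :=
  HasCompactSupport.of_support_subset_isCompact isCompact_Icc
    ((subset_tsupport _).trans hh.tsupport_deriv_subset)

/-- The derivative of a profile transition is bounded. [folklore] -/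
theorem exists_deriv_le (hh : IsProfileTransition h s ε) : ∃ B, 0 ≤ B ∧ ∀ x, deriv h x ≤ B := by
  obtain ⟨B, hB⟩ := hh.continuous_deriv.bounded_above_of_compact_support hh.hasCompactSupport_deriv
  refine ⟨max B 0, le_max_right _ _, fun x => le_trans ?_ (le_max_left _ _)⟩
  exact (le_abs_self _).trans ((Real.norm_eq_abs _).symm.le.trans (hB x))

/-- Translating a profile transition translates its location. [folklore] -/
theorem comp_sub (hh : IsProfileTransition h s ε) (c : ℝ) :
    IsProfileTransition (fun x => h (x - c)) (s + c) ε where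
  contDiff := hh.contDiff.comp (contDiff_id.sub contDiff_const)
  monotone := fun x y hxy => hh.monotone (by linarith)
  eq_zero_of_le := fun x hx => hh.eq_zero_of_le _ (by linarith)
  eq_one_of_le := fun x hx => hh.eq_one_of_le _ (by linarith)

/-- Derivative of a translated transition. [folklore] -/
theorem deriv_comp_sub (hh : IsProfileTransition h s ε) (c x : ℝ) :
    deriv (fun y => h (y - c)) x = deriv h (x - c) := by
  have := (hh.hasDerivAt (x - c)).comp x ((hasDerivAt_id x).sub_const c)
  simp only [mul_one] at this
  exact this.deriv

/-- A transition at scale `ε` is a transition at every larger scale. [folklore] -/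
theorem mono (hh : IsProfileTransition h s ε) {ε' : ℝ} (hε' : ε ≤ ε') : IsProfileTransition h s ε' where
  contDiff := hh.contDiff
  monotone := hh.monotone
  eq_zero_of_le := fun x hx => hh.eq_zero_of_le x (by linarith)
  eq_one_of_le := fun x hx => hh.eq_one_of_le x (by linarith)

end IsProfileTransition

/-! ### The profile kernel `½ h^{p-1} h'` -/

/-- The **profile kernel** `½ h(x)^{p-1} h'(x)` of a transition `h` in dimension `p` — the radial
density of `(dd^c g(log ‖z‖))^p` along complex `p`-planes through the origin, `g' = h`.
[cite: Chirka1989, §15.1] -/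
def profileKernel (h : ℝ → ℝ) (p : ℕ) (x : ℝ) : ℝ := h x ^ (p - 1) * deriv h x / 2

/-- Unfolding the profile kernel. [folklore] -/
theorem profileKernel_def (h : ℝ → ℝ) (p : ℕ) (x : ℝ) :
    profileKernel h p x = h x ^ (p - 1) * deriv h x / 2 := rfl

namespace IsProfileTransition

variable {h : ℝ → ℝ} {s ε : ℝ}

/-- The profile kernel is non-negative. [folklore] -/
theorem profileKernel_nonneg (hh : IsProfileTransition h s ε) (p : ℕ) (x : ℝ) :
    0 ≤ profileKernel h p x :=
  div_nonneg (mul_nonneg (pow_nonneg (hh.nonneg x) _) (hh.deriv_nonneg x)) zero_le_two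

/-- The profile kernel vanishes left of the band. [folklore] -/
theorem profileKernel_eq_zero_of_le (hh : IsProfileTransition h s ε) (p : ℕ) {x : ℝ} (hx : x ≤ s - ε) :
    profileKernel h p x = 0 := by
  simp [profileKernel, hh.deriv_eq_zero_of_le hx]

/-- The profile kernel vanishes right of the band. [folklore] -/
theorem profileKernel_eq_zero_of_ge (hh : IsProfileTransition h s ε) (p : ℕ) {x : ℝ} (hx : s + ε ≤ x) :
    profileKernel h p x = 0 := by
  simp [profileKernel, hh.deriv_eq_zero_of_ge hx]

/-- The profile kernel vanishes off the open band `|x - s| < ε`. [folklore] -/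
theorem profileKernel_eq_zero_of_lt_abs (hh : IsProfileTransition h s ε) (p : ℕ) {x : ℝ}
    (hx : ε ≤ |x - s|) : profileKernel h p x = 0 := by
  simp [profileKernel, hh.deriv_eq_zero_of_lt_abs hx]

/-- The profile kernel is continuous. [folklore] -/
theorem continuous_profileKernel (hh : IsProfileTransition h s ε) (p : ℕ) :
    Continuous (profileKernel h p) :=
  ((hh.contDiff.continuous.pow _).mul hh.continuous_deriv).div_const _

/-- The profile kernel is bounded: `½ h^{p-1} h' ≤ B/2` with `B` a bound for `h'`. [folklore] -/
theorem exists_profileKernel_le (hh : IsProfileTransition h s ε) (p : ℕ) :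
    ∃ B, 0 ≤ B ∧ ∀ x, profileKernel h p x ≤ B := by
  obtain ⟨B, hB0, hB⟩ := hh.exists_deriv_le
  refine ⟨B / 2, by positivity, fun x => ?_⟩
  rw [profileKernel]
  gcongr
  calc h x ^ (p - 1) * deriv h x ≤ 1 * deriv h x := by
        gcongr
        · exact hh.deriv_nonneg x
        · exact pow_le_one₀ (hh.nonneg x) (hh.le_one x)
    _ = deriv h x := one_mul _
    _ ≤ B := hB x

/-- The kernel of a translated transition is the translated kernel. [folklore] -/
theorem profileKernel_comp_sub (hh : IsProfileTransition h s ε) (p : ℕ) (c x : ℝ) :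
    profileKernel (fun y => h (y - c)) p x = profileKernel h p (x - c) := by
  simp [profileKernel, hh.deriv_comp_sub]

/-- `x ↦ h(x)^p/(2p)` is a primitive of the profile kernel (`p ≥ 1`). [folklore] -/
theorem hasDerivAt_pow_div (hh : IsProfileTransition h s ε) {p : ℕ} (hp : 1 ≤ p) (x : ℝ) :
    HasDerivAt (fun y => h y ^ p / (2 * p)) (profileKernel h p x) x := by
  have h1 : HasDerivAt (fun y => h y ^ p / (2 * p)) (p * h x ^ (p - 1) * deriv h x / (2 * p)) x :=
    ((hh.hasDerivAt x).fun_pow p).div_const (2 * (p : ℝ))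
  refine h1.congr_deriv ?_
  rw [profileKernel_def]
  have hp0 : (p : ℝ) ≠ 0 := by exact_mod_cast (show p ≠ 0 by omega)
  field_simp

/-- **Integral of the profile kernel**: `∫_a^b ½ h^{p-1} h' = (h(b)^p - h(a)^p)/(2p)`.
[folklore] -/
theorem integral_profileKernel (hh : IsProfileTransition h s ε) {p : ℕ} (hp : 1 ≤ p) (a b : ℝ) :
    ∫ x in a..b, profileKernel h p x = h b ^ p / (2 * p) - h a ^ p / (2 * p) :=
  integral_eq_sub_of_hasDerivAt (fun x _ => hh.hasDerivAt_pow_div hp x)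
    ((hh.continuous_profileKernel p).intervalIntegrable _ _)

/-- The total mass of the profile kernel over any interval containing `[s - ε, s + ε]` is `1/(2p)`.
[folklore] -/
theorem integral_profileKernel_eq (hh : IsProfileTransition h s ε) {p : ℕ} (hp : 1 ≤ p) {a b : ℝ}
    (ha : a ≤ s - ε) (hb : s + ε ≤ b) :
    ∫ x in a..b, profileKernel h p x = 1 / (2 * p) := by
  rw [hh.integral_profileKernel hp, hh.eq_one_of_le b hb, hh.eq_zero_of_le a ha, one_pow,
    zero_pow (by omega), zero_div, sub_zero]

/-- Bounds for the primitive: `0 ≤ (h(b)^p - h(a)^p)/(2p) ≤ 1/(2p)` for `a ≤ b`. [folklore] -/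
theorem integral_profileKernel_nonneg (hh : IsProfileTransition h s ε) (p : ℕ) {a b : ℝ}
    (hab : a ≤ b) : 0 ≤ ∫ x in a..b, profileKernel h p x :=
  integral_nonneg hab fun x _ => hh.profileKernel_nonneg p x

/-- The integral of the profile kernel over any interval is at most `1/(2p)`. [folklore] -/
theorem integral_profileKernel_le (hh : IsProfileTransition h s ε) {p : ℕ} (hp : 1 ≤ p) (a b : ℝ) :
    ∫ x in a..b, profileKernel h p x ≤ 1 / (2 * p) := by
  rcases le_total a b with hab | hab
  · rw [hh.integral_profileKernel hp]
    have hp0 : (0 : ℝ) < 2 * p := by positivity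
    have h1 : h b ^ p / (2 * p) ≤ 1 / (2 * p) := by
      gcongr
      exact pow_le_one₀ (hh.nonneg b) (hh.le_one b)
    have h2 : 0 ≤ h a ^ p / (2 * p) := by
      have := pow_nonneg (hh.nonneg a) p
      positivity
    linarith
  · rw [integral_symm, hh.integral_profileKernel hp]
    have hp0 : (0 : ℝ) < 2 * p := by positivity
    have hmono : h b ^ p / (2 * p) ≤ h a ^ p / (2 * p) := by
      gcongr
      · exact hh.nonneg b
      · exact hh.monotone hab
    have : (0 : ℝ) ≤ 1 / (2 * p) := by positivity
    linarith

end IsProfileTransition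

end Literature.Geometry.GeometricMeasureTheory

end
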